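import Literature.InformationTheory.QuantumCodes.QuantumExpanderLTZLemma8Weight
import Literature.InformationTheory.QuantumCodes.QuantumExpanderCodeParameters
import HarnessLib

/-!
# Robustness of quantum expander codes with the printed constant `1/3` (LTZ15 Cor 9): as printed for
# near-balanced degrees, and at radius `(3/5)·min(γ_A n_A, γ_B n_B)` for all degrees — PROOF

Index of sources: `[cite: LeverrierTillichZemor2015]` = Leverrier–Tillich–Zémor, FOCS 2015 / arXiv:1504.00822v1, Cor 9
"Robustness" (p0009 L9-11: "Any error `e` with reduced weight `w_R(e) < min(γ_A n_A, γ_B n_B)` has a syndrome with weight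
bounded from below as `|σ(e)| ≥ (1/3) w_R(e)`") and its proof (p0009 L13-31: iterate Lemma 8; "Moreover, since
`w_R(e+e₁) ≤ |e|`, we can apply Lemma 8 again to `e + e₁` and iterate"; at the end Cor 5 puts `e + e₁ + ⋯ + e_i` in `C_Z^⊥`).

qec PARTITION v2 row 04 (`prover-qec-type-04`, gen 6), item «E-7 repair as mathematics». The printed proof of Cor 9 uses
clause (ii) of Lemma 8 (`w_R(e+e₁) ≤ w_R(e)`), whose printed case-4 argument is complete only for (near-)balanced degrees
(finding E-7; see `QuantumExpanderLTZLemma8Weight.lean`). Writing `R = min(γ_A n_A, γ_B n_B)` and phrasing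
"`|σ_X(e)| ≥ w_R(e)/3`" without a `w_R` symbol as "some word `e'` of `e + C_Z^⊥` has `|e'| ≤ 3|σ_X(e)|`", this file proves:

* `ltz15_corollary9_near_balanced` — **Cor 9 exactly as printed** (radius `R`, constant `1/3`) under the extra hypothesis
  `|Δ_A − Δ_B| ≤ 5` (in particular `Δ_A = Δ_B`, the case of all of LTZ15's and FGL18's examples), by the printed iteration;
* `ltz15_corollary9_potential` — for ALL degrees: if `w_R(e) ≤ R` and `w_R(e) + 2|σ_X(e)| ≤ R + 2` then
  `|σ_X(e)| ≥ w_R(e)/3`. The printed iteration, run with the weak clause `w_R(e+e₁) ≤ w_R(e) + 2(|σ_X(e)| − |σ_X(e+e₁)|) − 2`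
  (true for all degrees): the potential `w_R + 2|σ_X|` never increases, so the iteration stays inside the Lemma-8 ball;
* `ltz15_corollary9_three_fifths` — for ALL degrees: `w_R(e) < (3/5)·R ⟹ |σ_X(e)| ≥ w_R(e)/3` (if `3|σ_X(e)| < w_R(e)` the
  potential is `< (5/3) w_R(e) < R`).

HONEST FRAMING: the second and third statements are OUR repair (constant `1/3` kept, radius shrunk to `3R/5` or replaced
by the potential condition); the printed radius `R` for all `(Δ_A, Δ_B)` is neither claimed nor refuted here. The tree's
`syndrome_weight_ge_beta_reducedWeight` (β-decoder route, other constants) is independent of this file.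
PROVED (kernel axioms); no definitions, no named facts.
-/

namespace Literature.InformationTheory.QuantumCodes

namespace QuantumExpander

open Finset Matrix

variable {A B : Type*} [Fintype A] [Fintype B] [DecidableEq A] [DecidableEq B]

/-- Base of the iteration (end of the printed proof): a word with zero `σ_X`-syndrome and weight `≤ min(γ_A n_A, γ_B n_B)`
lies in `C_Z^⊥` (LTZ15 Cor 5, the tree's `min_lt_hammingNorm_of_isBiregular`), so `0` is a word of its coset of weight
`≤ 3·0`. [cite: LeverrierTillichZemor2015, Cor 9 proof, last step ("This last fact implies by Corollary 5 that … is in C_Z^⊥"; arXiv v1 p0009 L27-30)] -/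
theorem exists_coset_word_of_syndrome_eq_zero (H : Matrix B A (ZMod 2)) {dA dB : ℕ} {γA δA γB δB : ℝ}
    (hreg : IsBiregular H dA dB) (hexp : IsLeftRightExpanding H dA dB γA δA γB δB)
    (hdA : 0 < dA) (hdB : 0 < dB) (hδA' : δA < 1 / 6) (hδB' : δB < 1 / 6)
    {f : (A × A) ⊕ (B × B) → ZMod 2} (hσ : expanderHX H *ᵥ f = 0)
    (hw : (hammingNorm f : ℝ) ≤ min (γA * Fintype.card A) (γB * Fintype.card B)) :
    ∃ f' : (A × A) ⊕ (B × B) → ZMod 2, f' + f ∈ rowSpace (expanderHZ H) ∧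
      hammingNorm f' ≤ 3 * hammingNorm (expanderHX H *ᵥ f) := by
  refine ⟨0, ?_, by simp⟩
  rw [zero_add]
  by_contra hf
  have hlt := min_lt_hammingNorm_of_isBiregular H hreg hdA hdB hexp (by linarith) (by linarith)
    (Or.inl ⟨(mem_pcCode_iff _ _).2 hσ, hf⟩)
  linarith

/-- One step of bookkeeping shared by both iterations: from Lemma 8's flip `F` and coset word `e'` of `e + 𝟙_F`, the
syndrome of `e'` is `σ_X(e) ⊕ σ_X(F)`, of weight `|σ_X(e)| − (decrease)`, and the decrease is a positive integer.
[cite: LeverrierTillichZemor2015, Cor 9 proof (arXiv v1 p0009 L13-25)] -/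
theorem syndrome_step_bookkeeping (H : Matrix B A (ZMod 2)) {f e' : (A × A) ⊕ (B × B) → ZMod 2}
    {F : Finset ((A × A) ⊕ (B × B))} (hF : F ∈ smallSets (expanderHZ H))
    (hF3 : (F.card : ℝ) ≤ 3 * syndromeDecrease (expanderHX H) (expanderHX H *ᵥ f) F)
    (he' : e' - (f + flipVec F) ∈ rowSpace (expanderHZ H)) :
    expanderHX H *ᵥ e' = expanderHX H *ᵥ f + expanderHX H *ᵥ flipVec F ∧
      (hammingNorm (expanderHX H *ᵥ e') : ℤ)
        = hammingNorm (expanderHX H *ᵥ f) - syndromeDecrease (expanderHX H) (expanderHX H *ᵥ f) F ∧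
      1 ≤ syndromeDecrease (expanderHX H) (expanderHX H *ᵥ f) F := by
  have hsyn : expanderHX H *ᵥ e' = expanderHX H *ᵥ f + expanderHX H *ᵥ flipVec F := by
    have h0 := expanderHX_mulVec_eq_zero_of_mem_rowSpace H he'
    rw [Matrix.mulVec_sub, sub_eq_zero, Matrix.mulVec_add] at h0
    exact h0
  refine ⟨hsyn, ?_, ?_⟩
  · rw [hsyn, syndromeDecrease]; ring
  · have h1 : (1 : ℝ) ≤ F.card := by exact_mod_cast card_pos_of_mem_smallSets hF
    have h2 : (0 : ℝ) < syndromeDecrease (expanderHX H) (expanderHX H *ᵥ f) F := by linarith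
    have h3 : (0 : ℤ) < syndromeDecrease (expanderHX H) (expanderHX H *ᵥ f) F := by exact_mod_cast h2
    exact h3

/-- The printed iteration with the potential `|·| + 2|σ_X(·)|` (all degrees): every word `f` with `|f| ≤ R` and
`|f| + 2|σ_X(f)| ≤ R + 2` (`R = min(γ_A n_A, γ_B n_B)`) has a coset word of weight `≤ 3|σ_X(f)|`. Induction on `|σ_X(f)|`;
the step is Lemma 8 with the weak weight clause (`exists_smallSet_decrease_third_weight`), under which the potential does
not increase. STATUS: OURS, not the printed statement. [cite: LeverrierTillichZemor2015, Cor 9 proof (arXiv v1 p0009 L13-31)] -/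
theorem ltz15_corollary9_potential_self (H : Matrix B A (ZMod 2)) {dA dB : ℕ} {γA δA γB δB : ℝ}
    (hreg : IsBiregular H dA dB) (hexp : IsLeftRightExpanding H dA dB γA δA γB δB)
    (hdA : 0 < dA) (hdB : 0 < dB) (hδA : 0 < δA) (hδA' : δA < 1 / 6) (hδB : 0 < δB) (hδB' : δB < 1 / 6)
    (n : ℕ) :
    ∀ f : (A × A) ⊕ (B × B) → ZMod 2, hammingNorm (expanderHX H *ᵥ f) ≤ n →
      (hammingNorm f : ℝ) ≤ min (γA * Fintype.card A) (γB * Fintype.card B) →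
      (hammingNorm f : ℝ) + 2 * hammingNorm (expanderHX H *ᵥ f)
          ≤ min (γA * Fintype.card A) (γB * Fintype.card B) + 2 →
      ∃ f' : (A × A) ⊕ (B × B) → ZMod 2, f' + f ∈ rowSpace (expanderHZ H) ∧
        hammingNorm f' ≤ 3 * hammingNorm (expanderHX H *ᵥ f) := by
  induction n with
  | zero =>
    intro f hσ hw _
    have h0 : expanderHX H *ᵥ f = 0 := by rwa [Nat.le_zero, hammingNorm_eq_zero] at hσ
    exact exists_coset_word_of_syndrome_eq_zero H hreg hexp hdA hdB hδA' hδB' h0 hw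
  | succ n ih =>
    intro f hσ hw hpot
    by_cases h0 : expanderHX H *ᵥ f = 0
    · exact exists_coset_word_of_syndrome_eq_zero H hreg hexp hdA hdB hδA' hδB' h0 hw
    · have hnot : f ∉ rowSpace (expanderHZ H) := fun h => h0 (expanderHX_mulVec_eq_zero_of_mem_rowSpace H h)
      obtain ⟨F, hF, e', hF3, he', hwt, -⟩ := exists_smallSet_decrease_third_weight H hreg hexp hdA hdB hδA hδA'
        hδB hδB' f hnot (hw.trans (min_le_left _ _)) (hw.trans (min_le_right _ _))
      obtain ⟨hsyn, hwtσ, hdec1⟩ := syndrome_step_bookkeeping H hF hF3 he'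
      set dec := syndromeDecrease (expanderHX H) (expanderHX H *ᵥ f) F with hdec
      have hwtσR : (hammingNorm (expanderHX H *ᵥ e') : ℝ) = hammingNorm (expanderHX H *ᵥ f) - dec := by
        exact_mod_cast hwtσ
      have hdec1R : (1 : ℝ) ≤ dec := by exact_mod_cast hdec1
      -- the induction hypothesis applies to `e'`
      have hσ' : hammingNorm (expanderHX H *ᵥ e') ≤ n := by
        have h1 : (hammingNorm (expanderHX H *ᵥ e') : ℤ) ≤ (n + 1 : ℕ) - 1 := by
          rw [hwtσ]; push_cast
          have : (hammingNorm (expanderHX H *ᵥ f) : ℤ) ≤ (n + 1 : ℕ) := by exact_mod_cast hσ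
          push_cast at this; linarith
        have h2 : (hammingNorm (expanderHX H *ᵥ e') : ℤ) ≤ n := by push_cast at h1; linarith
        exact_mod_cast h2
      have hw' : (hammingNorm e' : ℝ) ≤ min (γA * Fintype.card A) (γB * Fintype.card B) := by
        have : (0 : ℝ) ≤ hammingNorm (expanderHX H *ᵥ e') := Nat.cast_nonneg _
        linarith
      have hpot' : (hammingNorm e' : ℝ) + 2 * hammingNorm (expanderHX H *ᵥ e')
          ≤ min (γA * Fintype.card A) (γB * Fintype.card B) + 2 := by linarith
      obtain ⟨f'', hf'', hwf''⟩ := ih e' hσ' hw' hpot'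
      refine ⟨f'' + flipVec F, ?_, ?_⟩
      · have : f'' + flipVec F + f = (f'' + e') - (e' - (f + flipVec F)) := by abel
        rw [this]; exact Submodule.sub_mem _ hf'' he'
      · have h1 : hammingNorm (f'' + flipVec F) ≤ hammingNorm f'' + F.card := by
          have := hammingNorm_add_flipVec f'' F; omega
        have h2 : (hammingNorm (f'' + flipVec F) : ℝ) ≤ 3 * hammingNorm (expanderHX H *ᵥ f) := by
          have h1' : (hammingNorm (f'' + flipVec F) : ℝ) ≤ hammingNorm f'' + F.card := by exact_mod_cast h1
          have h3 : (hammingNorm f'' : ℝ) ≤ 3 * hammingNorm (expanderHX H *ᵥ e') := by exact_mod_cast hwf''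
          rw [hwtσR] at h3
          linarith
        exact_mod_cast h2

/-- The printed iteration as printed (monotone reduced weight), for near-balanced degrees `|Δ_A − Δ_B| ≤ 5`: every word
`f` with `|f| ≤ R` has a coset word of weight `≤ 3|σ_X(f)|`. Induction on `|σ_X(f)|`; the step is Lemma 8 with its printed
clause (ii). STATUS: the PRINTED argument under the ADDED hypothesis `|Δ_A − Δ_B| ≤ 5`. [cite: LeverrierTillichZemor2015, Cor 9 proof (arXiv v1 p0009 L13-31)] -/
theorem ltz15_corollary9_near_balanced_self (H : Matrix B A (ZMod 2)) {dA dB : ℕ} {γA δA γB δB : ℝ}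
    (hreg : IsBiregular H dA dB) (hexp : IsLeftRightExpanding H dA dB γA δA γB δB)
    (hdA : 0 < dA) (hdB : 0 < dB) (hδA : 0 < δA) (hδA' : δA < 1 / 6) (hδB : 0 < δB) (hδB' : δB < 1 / 6)
    (hbal : |(dA : ℝ) - dB| ≤ 5) (n : ℕ) :
    ∀ f : (A × A) ⊕ (B × B) → ZMod 2, hammingNorm (expanderHX H *ᵥ f) ≤ n →
      (hammingNorm f : ℝ) ≤ min (γA * Fintype.card A) (γB * Fintype.card B) →
      ∃ f' : (A × A) ⊕ (B × B) → ZMod 2, f' + f ∈ rowSpace (expanderHZ H) ∧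
        hammingNorm f' ≤ 3 * hammingNorm (expanderHX H *ᵥ f) := by
  induction n with
  | zero =>
    intro f hσ hw
    have h0 : expanderHX H *ᵥ f = 0 := by rwa [Nat.le_zero, hammingNorm_eq_zero] at hσ
    exact exists_coset_word_of_syndrome_eq_zero H hreg hexp hdA hdB hδA' hδB' h0 hw
  | succ n ih =>
    intro f hσ hw
    by_cases h0 : expanderHX H *ᵥ f = 0
    · exact exists_coset_word_of_syndrome_eq_zero H hreg hexp hdA hdB hδA' hδB' h0 hw
    · have hnot : f ∉ rowSpace (expanderHZ H) := fun h => h0 (expanderHX_mulVec_eq_zero_of_mem_rowSpace H h)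
      obtain ⟨F, hF, e', hF3, he', -, hwt⟩ := exists_smallSet_decrease_third_weight H hreg hexp hdA hdB hδA hδA'
        hδB hδB' f hnot (hw.trans (min_le_left _ _)) (hw.trans (min_le_right _ _))
      have hwt := hwt hbal
      obtain ⟨hsyn, hwtσ, hdec1⟩ := syndrome_step_bookkeeping H hF hF3 he'
      set dec := syndromeDecrease (expanderHX H) (expanderHX H *ᵥ f) F with hdec
      have hwtσR : (hammingNorm (expanderHX H *ᵥ e') : ℝ) = hammingNorm (expanderHX H *ᵥ f) - dec := by
        exact_mod_cast hwtσ
      have hσ' : hammingNorm (expanderHX H *ᵥ e') ≤ n := by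
        have h1 : (hammingNorm (expanderHX H *ᵥ e') : ℤ) ≤ (n + 1 : ℕ) - 1 := by
          rw [hwtσ]; push_cast
          have : (hammingNorm (expanderHX H *ᵥ f) : ℤ) ≤ (n + 1 : ℕ) := by exact_mod_cast hσ
          push_cast at this; linarith
        have h2 : (hammingNorm (expanderHX H *ᵥ e') : ℤ) ≤ n := by push_cast at h1; linarith
        exact_mod_cast h2
      have hw' : (hammingNorm e' : ℝ) ≤ min (γA * Fintype.card A) (γB * Fintype.card B) :=
        le_trans (by exact_mod_cast hwt) hw
      obtain ⟨f'', hf'', hwf''⟩ := ih e' hσ' hw'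
      refine ⟨f'' + flipVec F, ?_, ?_⟩
      · have : f'' + flipVec F + f = (f'' + e') - (e' - (f + flipVec F)) := by abel
        rw [this]; exact Submodule.sub_mem _ hf'' he'
      · have h1 : hammingNorm (f'' + flipVec F) ≤ hammingNorm f'' + F.card := by
          have := hammingNorm_add_flipVec f'' F; omega
        have h2 : (hammingNorm (f'' + flipVec F) : ℝ) ≤ 3 * hammingNorm (expanderHX H *ᵥ f) := by
          have h1' : (hammingNorm (f'' + flipVec F) : ℝ) ≤ hammingNorm f'' + F.card := by exact_mod_cast h1
          have h3 : (hammingNorm f'' : ℝ) ≤ 3 * hammingNorm (expanderHX H *ᵥ e') := by exact_mod_cast hwf''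
          rw [hwtσR] at h3
          linarith
        exact_mod_cast h2

/-- Coset transfer used by the three corollaries: the syndrome is constant on `e + C_Z^⊥`, and coset words compose.
[cite: LeverrierTillichZemor2015, Cor 9 proof ("suppose e is a representative of e + C_Z^⊥ with minimum weight"; arXiv v1 p0009 L13-14)] -/
theorem coset_transfer (H : Matrix B A (ZMod 2)) {e e₀ f' : (A × A) ⊕ (B × B) → ZMod 2}
    (he₀ : e₀ + e ∈ rowSpace (expanderHZ H)) (hf' : f' + e₀ ∈ rowSpace (expanderHZ H)) :
    expanderHX H *ᵥ e₀ = expanderHX H *ᵥ e ∧ f' + e ∈ rowSpace (expanderHZ H) := by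
  constructor
  · have h0 := expanderHX_mulVec_eq_zero_of_mem_rowSpace H he₀
    rw [Matrix.mulVec_add] at h0
    have : expanderHX H *ᵥ e₀ = -(expanderHX H *ᵥ e) := eq_neg_of_add_eq_zero_left h0
    rw [this]; funext c; simp only [Pi.neg_apply, ZMod.neg_eq_self_mod_two]
  · have hsum : f' + e = (f' + e₀) + (e₀ + e) := by
      funext q
      simp only [Pi.add_apply]
      have h2 : e₀ q + e₀ q = 0 := by
        rw [← two_mul]
        have : (2 : ZMod 2) = 0 := by decide
        rw [this, zero_mul]
      linear_combination -h2
    rw [hsum]; exact Submodule.add_mem _ hf' he₀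

/-- **LTZ15 Corollary 9 (Robustness), exactly as printed, for near-balanced degrees `|Δ_A − Δ_B| ≤ 5`** (in particular
`Δ_A = Δ_B`): for a `(Δ_A,Δ_B)`-biregular `(γ_A,δ_A,γ_B,δ_B)`-expander with `δ_A, δ_B < 1/6`, "any error `e` with reduced
weight `w_R(e) < min(γ_A n_A, γ_B n_B)` has a syndrome with weight bounded from below as `|σ(e)| ≥ (1/3) w_R(e)`": if the
coset `e + C_Z^⊥` contains a word `e₀` with `|e₀| < min(γ_A n_A, γ_B n_B)`, it contains a word `e'` with
`|e'| ≤ 3|σ_X(e)|`. STATUS: the PRINTED statement (constant `1/3`, radius `R`) under the ADDED hypothesis `|Δ_A − Δ_B| ≤ 5`;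
the hypothesis is ours — it is what makes the printed proof of Lemma 8 (ii) complete (finding E-7).
[cite: LeverrierTillichZemor2015, Cor 9 (arXiv v1 p0009 L9-31)] -/
theorem ltz15_corollary9_near_balanced (H : Matrix B A (ZMod 2)) {dA dB : ℕ} {γA δA γB δB : ℝ}
    (hreg : IsBiregular H dA dB) (hexp : IsLeftRightExpanding H dA dB γA δA γB δB)
    (hdA : 0 < dA) (hdB : 0 < dB) (hδA : 0 < δA) (hδA' : δA < 1 / 6) (hδB : 0 < δB) (hδB' : δB < 1 / 6)
    (hbal : |(dA : ℝ) - dB| ≤ 5)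
    {e e₀ : (A × A) ⊕ (B × B) → ZMod 2} (he₀ : e₀ + e ∈ rowSpace (expanderHZ H))
    (hw : (hammingNorm e₀ : ℝ) < min (γA * Fintype.card A) (γB * Fintype.card B)) :
    ∃ e' : (A × A) ⊕ (B × B) → ZMod 2, e' + e ∈ rowSpace (expanderHZ H) ∧
      hammingNorm e' ≤ 3 * hammingNorm (expanderHX H *ᵥ e) := by
  obtain ⟨f', hf', hwf'⟩ := ltz15_corollary9_near_balanced_self H hreg hexp hdA hdB hδA hδA' hδB hδB' hbal
    _ e₀ le_rfl hw.le
  obtain ⟨hsyn, hmem⟩ := coset_transfer H he₀ hf'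
  exact ⟨f', hmem, by rw [← hsyn]; exact hwf'⟩

/-- **Robustness with constant `1/3` for all degrees, potential form**: for a `(Δ_A,Δ_B)`-biregular
`(γ_A,δ_A,γ_B,δ_B)`-expander with `δ_A, δ_B < 1/6` and ANY `Δ_A, Δ_B ≥ 1`: if `e + C_Z^⊥` contains a word `e₀` with
`|e₀| ≤ R` and `|e₀| + 2|σ_X(e)| ≤ R + 2` (`R = min(γ_A n_A, γ_B n_B)`), it contains a word of weight `≤ 3|σ_X(e)|`
(i.e. `|σ_X(e)| ≥ w_R(e)/3`). STATUS: OURS, NOT the printed statement — our repair of the printed Cor 9 (constant `1/3`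
kept) via the non-increasing potential `w_R + 2|σ_X|`.
[cite: LeverrierTillichZemor2015, Cor 9 and its proof (arXiv v1 p0009 L9-31)] -/
theorem ltz15_corollary9_potential (H : Matrix B A (ZMod 2)) {dA dB : ℕ} {γA δA γB δB : ℝ}
    (hreg : IsBiregular H dA dB) (hexp : IsLeftRightExpanding H dA dB γA δA γB δB)
    (hdA : 0 < dA) (hdB : 0 < dB) (hδA : 0 < δA) (hδA' : δA < 1 / 6) (hδB : 0 < δB) (hδB' : δB < 1 / 6)
    {e e₀ : (A × A) ⊕ (B × B) → ZMod 2} (he₀ : e₀ + e ∈ rowSpace (expanderHZ H))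
    (hw : (hammingNorm e₀ : ℝ) ≤ min (γA * Fintype.card A) (γB * Fintype.card B))
    (hpot : (hammingNorm e₀ : ℝ) + 2 * hammingNorm (expanderHX H *ᵥ e)
      ≤ min (γA * Fintype.card A) (γB * Fintype.card B) + 2) :
    ∃ e' : (A × A) ⊕ (B × B) → ZMod 2, e' + e ∈ rowSpace (expanderHZ H) ∧
      hammingNorm e' ≤ 3 * hammingNorm (expanderHX H *ᵥ e) := by
  have hsyn := (coset_transfer H he₀ (f' := e₀) (by
    have : e₀ + e₀ = 0 := by
      funext q; simp only [Pi.add_apply, Pi.zero_apply]; exact (by decide : ∀ z : ZMod 2, z + z = 0) _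
    rw [this]; exact Submodule.zero_mem _)).1
  rw [← hsyn] at hpot
  obtain ⟨f', hf', hwf'⟩ := ltz15_corollary9_potential_self H hreg hexp hdA hdB hδA hδA' hδB hδB' _ e₀ le_rfl
    hw hpot
  obtain ⟨-, hmem⟩ := coset_transfer H he₀ hf'
  exact ⟨f', hmem, by rw [← hsyn]; exact hwf'⟩

/-- **Robustness with constant `1/3` at radius `(3/5)·min(γ_A n_A, γ_B n_B)`, all degrees**: for a
`(Δ_A,Δ_B)`-biregular `(γ_A,δ_A,γ_B,δ_B)`-expander with `δ_A, δ_B < 1/6` and any `Δ_A, Δ_B ≥ 1`, if `e + C_Z^⊥` contains a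
word `e₀` with `|e₀| < (3/5)·min(γ_A n_A, γ_B n_B)` then it contains a word of weight `≤ 3|σ_X(e)|`, i.e.
`|σ_X(e)| ≥ w_R(e)/3`. (If `3|σ_X(e)| ≥ |e₀|` take `e₀`; else the potential `|e₀| + 2|σ_X(e)| < (5/3)|e₀| < R`.) STATUS:
OURS, NOT the printed statement — constant `1/3` as printed, radius `3R/5` instead of the printed `R`. [cite: LeverrierTillichZemor2015, Cor 9 (arXiv v1 p0009 L9-11)] -/
theorem ltz15_corollary9_three_fifths (H : Matrix B A (ZMod 2)) {dA dB : ℕ} {γA δA γB δB : ℝ}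
    (hreg : IsBiregular H dA dB) (hexp : IsLeftRightExpanding H dA dB γA δA γB δB)
    (hdA : 0 < dA) (hdB : 0 < dB) (hδA : 0 < δA) (hδA' : δA < 1 / 6) (hδB : 0 < δB) (hδB' : δB < 1 / 6)
    {e e₀ : (A × A) ⊕ (B × B) → ZMod 2} (he₀ : e₀ + e ∈ rowSpace (expanderHZ H))
    (hw : (hammingNorm e₀ : ℝ) < 3 / 5 * min (γA * Fintype.card A) (γB * Fintype.card B)) :
    ∃ e' : (A × A) ⊕ (B × B) → ZMod 2, e' + e ∈ rowSpace (expanderHZ H) ∧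
      hammingNorm e' ≤ 3 * hammingNorm (expanderHX H *ᵥ e) := by
  by_cases h3 : hammingNorm e₀ ≤ 3 * hammingNorm (expanderHX H *ᵥ e)
  · exact ⟨e₀, he₀, h3⟩
  · push Not at h3
    have h3R : (3 * hammingNorm (expanderHX H *ᵥ e) : ℝ) < hammingNorm e₀ := by exact_mod_cast h3
    have hR0 : (0 : ℝ) ≤ min (γA * Fintype.card A) (γB * Fintype.card B) := by
      have : (0 : ℝ) ≤ hammingNorm e₀ := Nat.cast_nonneg _
      linarith
    refine ltz15_corollary9_potential H hreg hexp hdA hdB hδA hδA' hδB hδB' he₀ (by linarith) ?_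
    linarith

end QuantumExpander

end Literature.InformationTheory.QuantumCodes
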